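import Summits.BirchSwinnertonDyer.BirchSwinnertonDyer.Theorems.Rank2ObservatoryKernelWalkerT
import Summits.BirchSwinnertonDyer.BirchSwinnertonDyer.Theorems.Rank2ObservatoryRank3RootNumber
import HarnessLib

/-!
# Rank-2 observatory — torsion certificates, part A: order-3 tools and residue tests

HONEST FRAMING: per-curve certified theorems and census instruments; no claim on BSD in rank ≥ 2.

Generic layer of the KERNEL TORSION CENSUS (four files `Rank2ObservatoryTorsionCertA/B/C` and
`Rank2ObservatoryTorsionCert`). This part: the instance-robust form of Literature's
`WeierstrassCurve.torsionOrder`; `ψ₃(x(P)) = 0` for a point `P` with `P + P = -P` (Silverman AEC III,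
Ex. 3.7, proved here from the duplication formula); residue tests deciding that an integer cubic has
no rational root and that an integer is not a rational square; and, on an integral model `V`, the
consequences `E(ℚ)[3] = 0` (from a factorisation `ψ₃ = (q₀X - p₀)·c(X)` with `c` root-free over `ℚ` and
`4f(p₀/q₀) + (a₁p₀/q₀ + a₃)²` a non-square) and `E(ℚ)[3] = {𝒪, ±P₀}` (same with `P₀` a rational point of
order `3`).
-/

-- single-conjunct summit: `Summit.BirchSwinnertonDyer.BirchSwinnertonDyer.…` repeats the name by design
set_option linter.dupNamespace false

namespace Summit.BirchSwinnertonDyer.BirchSwinnertonDyer.Rank2Observatory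

open WeierstrassCurve Literature.NumberTheory.EllipticCurves

/-! ### Torsion order: instance-robust form and packaging -/

section Packaging

/-- Literature's `torsionOrder` (elaborated against the classical decidability instance) is the
cardinality of the torsion subgroup for any `DecidableEq` instance. [folklore] -/
theorem torsionOrder_eq_natCard {K : Type*} [Field K] [DecidableEq K] (W : WeierstrassCurve K) :
    W.torsionOrder = Nat.card (AddCommGroup.torsion W.toAffine.Point) := by
  unfold WeierstrassCurve.torsionOrder
  congr!

/-- If the points of finite order are exactly the members of a finset `S`, then
`#E(K)_tors = #S`. [folklore] -/
theorem torsionOrder_eq_card {K : Type*} [Field K] [DecidableEq K] (W : WeierstrassCurve K)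
    (S : Finset W.toAffine.Point) (h : ∀ τ : W.toAffine.Point, IsOfFinAddOrder τ ↔ τ ∈ S) :
    W.torsionOrder = S.card := by
  rw [torsionOrder_eq_natCard, ← Nat.card_eq_finsetCard]
  exact Nat.card_congr (Equiv.subtypeEquivRight fun τ => by
    rw [AddCommGroup.mem_torsion, h τ])

end Packaging

/-! ### The 3-division polynomial at a point of order 3 (any field) -/

section AnyField

variable {F : Type*} [Field F] [DecidableEq F] {W : WeierstrassCurve F}

/-- **`ψ₃(x(P)) = 0` for a point `P` of order `3`.** If `P = (x, y)` is nonsingular with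
`P + P = -P`, then the tangent at `P` is not vertical (`2y + a₁x + a₃ ≠ 0`) and the duplication
formula `x(2P) = x` clears to `3x⁴ + b₂x³ + 3b₄x² + 3b₆x + b₈ = 0`.
[cite: SilvermanAEC2009, III.2.3(d) and Exercise 3.7] -/
theorem psi3_eq_zero_of_add_self_eq_neg {x y : F} (hns : W.toAffine.Nonsingular x y)
    (h3 : (Affine.Point.some x y hns : W.toAffine.Point) + .some x y hns = -.some x y hns) :
    2 * y + W.a₁ * x + W.a₃ ≠ 0 ∧
      3 * x ^ 4 + W.b₂ * x ^ 3 + 3 * W.b₄ * x ^ 2 + 3 * W.b₆ * x + W.b₈ = 0 := by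
  have heq : y ^ 2 + W.a₁ * x * y + W.a₃ * y = x ^ 3 + W.a₂ * x ^ 2 + W.a₄ * x + W.a₆ :=
    (Affine.equation_iff x y).mp hns.left
  have hdval : y - W.toAffine.negY x y = 2 * y + W.a₁ * x + W.a₃ := by
    simp only [Affine.negY]; ring
  by_cases hy : y = W.toAffine.negY x y
  · exfalso
    rw [Affine.Point.add_self_of_Y_eq hy, Affine.Point.neg_some] at h3
    exact Affine.Point.some_ne_zero _ h3.symm
  · have hd : 2 * y + W.a₁ * x + W.a₃ ≠ 0 := by
      rw [← hdval]; exact sub_ne_zero.mpr hy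
    refine ⟨hd, ?_⟩
    rw [Affine.Point.add_self_of_Y_ne hy, Affine.Point.neg_some, Affine.Point.some.injEq] at h3
    obtain ⟨hX, -⟩ := h3
    set L := W.toAffine.slope x x y y with hL
    have hLD : L * (2 * y + W.a₁ * x + W.a₃) = 3 * x ^ 2 + 2 * W.a₂ * x + W.a₄ - W.a₁ * y := by
      rw [hL, Affine.slope_of_Y_ne rfl hy, hdval]; exact div_mul_cancel₀ _ hd
    simp only [Affine.addX] at hX
    have key : (L * (2 * y + W.a₁ * x + W.a₃)) ^ 2
        + W.a₁ * (L * (2 * y + W.a₁ * x + W.a₃)) * (2 * y + W.a₁ * x + W.a₃)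
        - (W.a₂ + 3 * x) * (2 * y + W.a₁ * x + W.a₃) ^ 2 = 0 := by
      linear_combination (2 * y + W.a₁ * x + W.a₃) ^ 2 * hX
    rw [hLD] at key
    simp only [WeierstrassCurve.b₂, WeierstrassCurve.b₄, WeierstrassCurve.b₆, WeierstrassCurve.b₈]
    linear_combination (-1 : F) * key - (W.a₁ ^ 2 + 4 * W.a₂ + 12 * x) * heq

/-- `3 • P = 0` iff `P + P = -P`. [folklore] -/
theorem three_nsmul_eq_zero_iff {A : Type*} [AddCommGroup A] (P : A) :
    3 • P = 0 ↔ P + P = -P := by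
  rw [show (3 : ℕ) = 2 + 1 from rfl, succ_nsmul, two_nsmul]
  exact ⟨eq_neg_of_add_eq_zero_left, fun h => by rw [h, neg_add_cancel]⟩

/-- A point `P = (x, y)` with `2 • P = 0` has a vertical tangent: `2y + a₁x + a₃ = 0`.
[cite: SilvermanAEC2009, III.2.3(a)] -/
theorem two_y_eq_of_two_nsmul_eq_zero {x y : F} (hns : W.toAffine.Nonsingular x y)
    (h2 : 2 • (Affine.Point.some x y hns : W.toAffine.Point) = 0) :
    2 * y + W.a₁ * x + W.a₃ = 0 := by
  rw [two_nsmul] at h2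
  have hneg := eq_neg_of_add_eq_zero_left h2
  rw [Affine.Point.neg_some, Affine.Point.some.injEq] at hneg
  obtain ⟨-, hy⟩ := hneg
  simp only [Affine.negY] at hy
  linear_combination hy

end AnyField

/-! ### Rational roots of integer cubics and rational squares, by residues -/

section Residues

/-- Boolean: `gcd(c₃, m) = 1` and `c₃z³ + c₂z² + c₁z + c₀` has no root in `ℤ/m`. Then the cubic has
no rational root (a root `n/d` in lowest terms has `d ∣ c₃`, so `d` is a unit mod `m`). [folklore] -/
def noRatRootB (c₃ c₂ c₁ c₀ : ℤ) : ℕ → Bool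
  | 0 => false
  | m + 1 => decide (Nat.Coprime c₃.natAbs (m + 1)) &&
      decide (∀ z : ZMod (m + 1), (c₃ : ZMod (m + 1)) * z ^ 3 + (c₂ : ZMod (m + 1)) * z ^ 2 +
        (c₁ : ZMod (m + 1)) * z + (c₀ : ZMod (m + 1)) ≠ 0)

/-- Soundness of `noRatRootB`: the integer cubic has no rational root. [folklore] -/
theorem ne_zero_of_noRatRootB {c₃ c₂ c₁ c₀ : ℤ} {m : ℕ} (h : noRatRootB c₃ c₂ c₁ c₀ m = true)
    (u : ℚ) : (c₃ : ℚ) * u ^ 3 + c₂ * u ^ 2 + c₁ * u + c₀ ≠ 0 := by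
  cases m with
  | zero => simp [noRatRootB] at h
  | succ m =>
  simp only [noRatRootB, Bool.and_eq_true, decide_eq_true_eq] at h
  obtain ⟨hcop, hroot⟩ := h
  intro hu
  set n : ℤ := u.num with hn
  set d : ℕ := u.den with hd
  have hud : u * (d : ℚ) = n := Rat.mul_den_eq_num u
  have hQ : (c₃ : ℚ) * (n : ℚ) ^ 3 + c₂ * (n : ℚ) ^ 2 * (d : ℚ) + c₁ * (n : ℚ) * (d : ℚ) ^ 2 +
      c₀ * (d : ℚ) ^ 3 = 0 := by
    rw [← hud]; linear_combination (u * (d : ℚ)) ^ 0 * (d : ℚ) ^ 3 * hu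
  have hZ : c₃ * n ^ 3 + c₂ * n ^ 2 * d + c₁ * n * d ^ 2 + c₀ * (d : ℤ) ^ 3 = 0 := by
    exact_mod_cast hQ
  have hdvd : (d : ℤ) ∣ c₃ * n ^ 3 :=
    ⟨-(c₂ * n ^ 2 + c₁ * n * d + c₀ * d ^ 2), by linear_combination hZ⟩
  have hcop' : IsCoprime (d : ℤ) n := by
    rw [Int.isCoprime_iff_gcd_eq_one, Int.gcd_comm]
    have hr := u.reduced
    unfold Int.gcd
    simpa using hr
  have hdc : (d : ℤ) ∣ c₃ := (hcop'.pow_right (n := 3)).dvd_of_dvd_mul_right hdvd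
  have hdm : Nat.Coprime d (m + 1) :=
    Nat.Coprime.coprime_dvd_left (Int.natAbs_dvd_natAbs.mpr hdc) hcop
  set du := ZMod.unitOfCoprime d hdm with hdu
  have hduc : ((du : (ZMod (m + 1))ˣ) : ZMod (m + 1)) = (d : ZMod (m + 1)) :=
    ZMod.coe_unitOfCoprime d hdm
  have hinv : (d : ZMod (m + 1)) * ((du⁻¹ : (ZMod (m + 1))ˣ) : ZMod (m + 1)) = 1 := by
    rw [← hduc]; exact Units.mul_inv du
  have hZ' := congrArg (Int.cast : ℤ → ZMod (m + 1)) hZ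
  push_cast at hZ'
  apply hroot ((n : ZMod (m + 1)) * ((du⁻¹ : (ZMod (m + 1))ˣ) : ZMod (m + 1)))
  set w : ZMod (m + 1) := ((du⁻¹ : (ZMod (m + 1))ˣ) : ZMod (m + 1)) with hw
  linear_combination w ^ 3 * hZ' +
    (-((c₂ : ZMod (m + 1)) * (n : ZMod (m + 1)) ^ 2 * w ^ 2) -
      (c₁ : ZMod (m + 1)) * (n : ZMod (m + 1)) * w * (1 + (d : ZMod (m + 1)) * w) -
      (c₀ : ZMod (m + 1)) * (1 + (d : ZMod (m + 1)) * w + (d : ZMod (m + 1)) ^ 2 * w ^ 2)) * hinv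

/-- Boolean: `D` is not a square in `ℤ/m`; then `D` is not a rational square. [folklore] -/
def nonSquareB (D : ℤ) : ℕ → Bool
  | 0 => false
  | m + 1 => decide (∀ z : ZMod (m + 1), z * z ≠ (D : ZMod (m + 1)))

/-- Soundness of `nonSquareB`. [folklore] -/
theorem not_isSquare_of_nonSquareB {D : ℤ} {m : ℕ} (h : nonSquareB D m = true) :
    ¬ IsSquare (D : ℚ) := by
  cases m with
  | zero => simp [nonSquareB] at h
  | succ m =>
  simp only [nonSquareB, decide_eq_true_eq] at h
  rw [Rat.isSquare_intCast_iff]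
  rintro ⟨r, hr⟩
  apply h (r : ZMod (m + 1))
  rw [hr]; push_cast; ring

end Residues

/-! ### Certificates on an integral model -/

section IntModel

variable (V : WeierstrassCurve ℤ)

/-- Boolean: `ψ₃ = (q₀X − p₀)·(c₃X³ + c₂X² + c₁X + c₀)` coefficientwise, where
`ψ₃ = 3X⁴ + b₂X³ + 3b₄X² + 3b₆X + b₈` is the 3-division polynomial of `V`. [folklore] -/
def psi3FactorB (p₀ q₀ c₃ c₂ c₁ c₀ : ℤ) : Bool :=
  decide (q₀ * c₃ = 3 ∧ q₀ * c₂ - p₀ * c₃ = V.b₂ ∧ q₀ * c₁ - p₀ * c₂ = 3 * V.b₄ ∧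
    q₀ * c₀ - p₀ * c₁ = 3 * V.b₆ ∧ -(p₀ * c₀) = V.b₈)

/-- Soundness of `psi3FactorB`: the factorisation holds over `ℚ`. [folklore] -/
theorem psi3_eq_mul_of_psi3FactorB {p₀ q₀ c₃ c₂ c₁ c₀ : ℤ}
    (h : psi3FactorB V p₀ q₀ c₃ c₂ c₁ c₀ = true) (u : ℚ) :
    3 * u ^ 4 + (V.b₂ : ℚ) * u ^ 3 + 3 * (V.b₄ : ℚ) * u ^ 2 + 3 * (V.b₆ : ℚ) * u + (V.b₈ : ℚ) =
      ((q₀ : ℚ) * u - p₀) * ((c₃ : ℚ) * u ^ 3 + c₂ * u ^ 2 + c₁ * u + c₀) := by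
  simp only [psi3FactorB, decide_eq_true_eq] at h
  obtain ⟨h1, h2, h3, h4, h5⟩ := h
  have h1' : (q₀ : ℚ) * c₃ = 3 := by exact_mod_cast h1
  have h2' : (q₀ : ℚ) * c₂ - p₀ * c₃ = V.b₂ := by exact_mod_cast h2
  have h3' : (q₀ : ℚ) * c₁ - p₀ * c₂ = 3 * V.b₄ := by exact_mod_cast h3
  have h4' : (q₀ : ℚ) * c₀ - p₀ * c₁ = 3 * V.b₆ := by exact_mod_cast h4
  have h5' : -((p₀ : ℚ) * c₀) = V.b₈ := by exact_mod_cast h5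
  linear_combination (-(u ^ 4)) * h1' - u ^ 3 * h2' - u ^ 2 * h3' - u * h4' - h5'

/-- **The `x`-coordinate of a rational point of order `3` is the rational root of `ψ₃`**, when the
cofactor cubic has no rational root. [cite: SilvermanAEC2009, III Exercise 3.7] -/
theorem qX_eq_of_add_self_eq_neg {p₀ q₀ c₃ c₂ c₁ c₀ : ℤ} {m : ℕ}
    (hfac : psi3FactorB V p₀ q₀ c₃ c₂ c₁ c₀ = true) (hc : noRatRootB c₃ c₂ c₁ c₀ m = true)
    {u v : ℚ} (hns : (V.map (Int.castRingHom ℚ)).toAffine.Nonsingular u v)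
    (h3 : (Affine.Point.some u v hns : (V.map (Int.castRingHom ℚ)).toAffine.Point) +
      .some u v hns = -.some u v hns) :
    2 * v + (V.a₁ : ℚ) * u + V.a₃ ≠ 0 ∧ (q₀ : ℚ) * u = p₀ := by
  obtain ⟨hd, hpsi⟩ := psi3_eq_zero_of_add_self_eq_neg hns h3
  have ha₁ : (V.map (Int.castRingHom ℚ)).a₁ = (V.a₁ : ℚ) := by simp [WeierstrassCurve.map]
  have ha₃ : (V.map (Int.castRingHom ℚ)).a₃ = (V.a₃ : ℚ) := by simp [WeierstrassCurve.map]
  rw [ha₁, ha₃] at hd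
  refine ⟨hd, ?_⟩
  simp only [map_b₂, map_b₄, map_b₆, map_b₈, eq_intCast, psi3_eq_mul_of_psi3FactorB V hfac u]
    at hpsi
  rcases mul_eq_zero.mp hpsi with h | h
  · linear_combination h
  · exact absurd h (ne_zero_of_noRatRootB hc u)

/-- The integer `q₀⁴·[(a₁u + a₃)² + 4(u³ + a₂u² + a₄u + a₆)]` at `u = p₀/q₀`: a rational point with
`x = p₀/q₀` exists iff this is a rational square. [folklore] -/
def threeDiscZ (p₀ q₀ : ℤ) : ℤ :=
  (V.a₁ * p₀ * q₀ + V.a₃ * q₀ ^ 2) ^ 2 +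
    4 * (p₀ ^ 3 * q₀ + V.a₂ * p₀ ^ 2 * q₀ ^ 2 + V.a₄ * p₀ * q₀ ^ 3 + V.a₆ * q₀ ^ 4)

/-- The Weierstrass equation of `V/ℚ` with integer coefficients made explicit. [folklore] -/
theorem equation_rat_of_nonsingular {u v : ℚ}
    (hns : (V.map (Int.castRingHom ℚ)).toAffine.Nonsingular u v) :
    v ^ 2 + (V.a₁ : ℚ) * u * v + V.a₃ * v = u ^ 3 + V.a₂ * u ^ 2 + V.a₄ * u + V.a₆ := by
  have h := (Affine.equation_iff u v).mp hns.left
  simpa [WeierstrassCurve.map] using h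

/-- **No rational `3`-torsion** when `ψ₃` has exactly one rational root `p₀/q₀` (cofactor without
rational roots) and no rational point has `x = p₀/q₀` (`threeDiscZ` a non-square): every `τ`
with `3 • τ = 0` is `𝒪`.  (The case of a curve `3`-isogenous to one with a rational `3`-torsion
point.) [cite: SilvermanAEC2009, III Exercise 3.7] -/
theorem eq_zero_of_three_nsmul_eq_zero {p₀ q₀ c₃ c₂ c₁ c₀ : ℤ} {m m' : ℕ}
    (hfac : psi3FactorB V p₀ q₀ c₃ c₂ c₁ c₀ = true) (hc : noRatRootB c₃ c₂ c₁ c₀ m = true)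
    (hD : nonSquareB (threeDiscZ V p₀ q₀) m' = true)
    (τ : (V.map (Int.castRingHom ℚ)).toAffine.Point) (hτ : 3 • τ = 0) : τ = 0 := by
  cases τ with
  | zero => rfl
  | @some u v hns =>
    exfalso
    have heq := equation_rat_of_nonsingular V hns
    obtain ⟨-, hx⟩ := qX_eq_of_add_self_eq_neg V hfac hc hns ((three_nsmul_eq_zero_iff _).mp hτ)
    apply not_isSquare_of_nonSquareB hD
    refine ⟨(q₀ : ℚ) ^ 2 * (2 * v + V.a₁ * u + V.a₃), ?_⟩
    simp only [threeDiscZ]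
    push_cast
    rw [← hx]
    linear_combination (-4 * (q₀ : ℚ) ^ 4) * heq

/-- **The rational `3`-torsion is `{𝒪, ±P₀}`** when `P₀ = (x₀, y₀)` is integral, `ψ₃ = (X − x₀)·c`
with `c` without rational roots: every `τ` with `3 • τ = 0` is `𝒪`, `P₀` or `−P₀`.
[cite: SilvermanAEC2009, III Exercise 3.7] -/
theorem eq_of_three_nsmul_eq_zero (hΔ : V.Δ ≠ 0) {x₀ y₀ : ℤ}
    (h₀ : y₀ ^ 2 + V.a₁ * x₀ * y₀ + V.a₃ * y₀ = x₀ ^ 3 + V.a₂ * x₀ ^ 2 + V.a₄ * x₀ + V.a₆)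
    {c₃ c₂ c₁ c₀ : ℤ} {m : ℕ} (hfac : psi3FactorB V x₀ 1 c₃ c₂ c₁ c₀ = true)
    (hc : noRatRootB c₃ c₂ c₁ c₀ m = true)
    (τ : (V.map (Int.castRingHom ℚ)).toAffine.Point) (hτ : 3 • τ = 0) :
    τ = 0 ∨ τ = .some (x₀ : ℚ) (y₀ : ℚ) (nonsingular_rat_of_eq V hΔ h₀) ∨
      τ = -.some (x₀ : ℚ) (y₀ : ℚ) (nonsingular_rat_of_eq V hΔ h₀) := by
  cases τ with
  | zero => exact Or.inl rfl
  | @some u v hns =>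
    right
    obtain ⟨-, hx⟩ := qX_eq_of_add_self_eq_neg V hfac hc hns ((three_nsmul_eq_zero_iff _).mp hτ)
    have hu : u = (x₀ : ℚ) := by simpa using hx
    subst hu
    rcases Affine.Y_eq_of_X_eq hns.left (nonsingular_rat_of_eq V hΔ h₀).left rfl with hv | hv
    · left; subst hv; rfl
    · right; rw [Affine.Point.neg_some]; subst hv; rfl

end IntModel

end Summit.BirchSwinnertonDyer.BirchSwinnertonDyer.Rank2Observatory
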